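import Literature.Analysis.FluidPDE.TorusNSSobolevTrilinear
import HarnessLib

/-!
# The Robinson–Sadowski–Silva commutator estimate
# `|(B(u,u), Λ^{2s}u)| ≤ c ‖u‖²_{Ḣ^s} ‖u‖_{F_1}` (`s ≥ 1`) on the torus, in Fourier variables

Analysis/FluidPDE support file (theorems only; no definitions, no named facts).
Search for candidate a priori estimates; no regularity claim.

Robinson–Sadowski–Silva 2012, §III, the second trilinear estimate (3.6): for `s ≥ 1`,
`|(B(u,u), A^s u)| ≤ c ‖u‖_s² ‖u‖_{F_1}`, `‖u‖_{F_1} = ∑_k |k| |û(k)|`. Printed proof: "Since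
`(B(u, Λ^s u), Λ^s u) = 0` we have `(Λ^{2s} B(u,u), u) = (Λ^s B(u,u), Λ^s u) − (B(u,Λ^s u), Λ^s u)`.
Therefore `|(B(u,u),Λ^{2s}u)| ≤ ∫∫ |k−j| |û(k−j)| ||k|^s − |j|^s| |û(j)| |k|^s |û(k)|`. Now we can
use the inequality `||k|^s − |j|^s| ≤ c|k−j|(|k−j|^{s−1} + |j|^{s−1})` (3.7) to obtain … (3.6)."
Here everything is done on the lattice `ℤ^n` (no function-level `Λ^s` is needed):

* `NSSobolev.mFourierCoeff_convect_apply_eq_tsum` — the convective term in Fourier variables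
  (advective form, any smooth `u, v`):
  `𝓕((u·∇)v)ₚ(k) = ∑_m (2πi ∑_j (k−m)_j û_j(m)) v̂ₚ(k−m)` (Foias–Temam 1989, (2.6));
* `NSSobolev.abs_rpow_sqrt_sub_rpow_sqrt_le` — the commutator inequality (3.7) on the lattice,
  `||k|^s − |l|^s| ≤ s 2^s |k−l| (|k−l|^{s−1} + |l|^{s−1})`, `s ≥ 1`;
* `NSSobolev.re_tsum_tsum_latticeConvect_eq_zero` — **the cancellation `(B(u,w), w) = 0` in
  Fourier variables**: for a transversal (`m·û(m) = 0`) conjugate-symmetric family `û` and any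
  family `ŵ`, `Re ∑_k ∑_l (2πi ∑_j l_j û_j(k−l)) ⟪ŵ(k), ŵ(l)⟫ = 0`;
* `NSSobolev.abs_tsum_rpow_mul_re_inner_convect_le` — **(3.6)**: for a smooth divergence-free
  real field `u` on `T^n` and `s ≥ 1`,
  `|∑_k |k|^{2s} Re⟪𝓕((u·∇)u)(k), û(k)⟫| ≤ 4π n s 2^s (∑_k |k|^{2s}‖û(k)‖²) (∑_k |k| ‖û(k)‖)`.

## Mathlib / tree search

Tree: `NSSobolev.norm_mFourierCoeff_convect_le_of_isDivFree` and its componentwise convolution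
identity (`TorusNSSobolevTrilinear`, re-derived here as an equality), `IsDivFree.sum_mul_mFourierCoeff_eq_zero`,
`isConjSymm_mFourierCoeff` (`TorusTrigPoly`), `NSGevrey.sum_mul_tsum_mul_le` (Young for lattice
convolutions), `NSGevrey.sqrt_freqNormSq_add_le`. Mathlib: `one_add_mul_self_le_rpow_one_add`
(Bernoulli), `Summable.tsum_prod`, `Summable.prod_symm`, `Equiv.tsum_eq`, `Complex.re_tsum`.
Searched `lean search 'commutator|Lambda.*convect|(3.6)'` in FluidPDE: nothing for `s ≥ 1`.

## References

* J. C. Robinson, W. Sadowski, R. P. Silva, *Lower bounds on blow up solutions of the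
  three-dimensional Navier–Stokes equations in homogeneous Sobolev spaces*, J. Math. Phys. 53
  (2012) 115618, §III (3.6)–(3.7) (held: paper:doi-10-1063-1-4762841, pp. 7, 9: (3.6) on p. 7,
  (3.7) and its use on p. 9). [RobinsonSadowskiSilva2012]
* C. Foias, R. Temam, *Gevrey class regularity for the solutions of the Navier–Stokes equations*,
  J. Funct. Anal. 87 (1989) 359–369, §2 (2.6). [FoiasTemam1989]
-/

noncomputable section

open MeasureTheory Set Filter UnitAddTorus Function Finset
open scoped Topology BigOperators InnerProductSpace ComplexConjugate

namespace Literature.Analysis.FluidPDE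

namespace NSSobolev

open Literature.Analysis.FunctionSpaces Literature.Analysis.FunctionSpaces.Torus NSGevrey
open ScalarFourier (lconv lconv_apply mFourierCoeff_mul)

variable {d : Type*} [Fintype d] [DecidableEq d]

variable {u v : UnitAddTorus d → EuclideanSpace ℝ d}

/-! ### §1 The convective term in Fourier variables (advective form) -/

/-- **`𝓕((u·∇)v)ₚ(k) = ∑_m (2πi ∑_j (k−m)_j û_j(m)) v̂ₚ(k−m)`** for smooth real fields `u, v` on
`T^n` (componentwise; products are lattice convolutions, `𝓕(∂_j g)(l) = 2πi l_j ĝ(l)`; the series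
converges absolutely). Foias–Temam 1989, (2.6). [cite: FoiasTemam1989, §2 (2.6)] -/
theorem mFourierCoeff_convect_apply_eq_tsum (hu : IsSmooth u) (hv : IsSmooth v) (k : d → ℤ)
    (p : d) :
    mFourierCoeff (EuclideanSpace.complexify ∘ Torus.convect u v) k p =
      ∑' m : d → ℤ, (2 * Real.pi * Complex.I *
        ∑ j, (((k - m) j : ℤ) : ℂ) * mFourierCoeff (EuclideanSpace.complexify ∘ u) m j) *
        mFourierCoeff (EuclideanSpace.complexify ∘ v) (k - m) p := by
  classical
  set U : (d → ℤ) → EuclideanSpace ℂ d := fun m => mFourierCoeff (EuclideanSpace.complexify ∘ u) m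
    with hU
  set V : (d → ℤ) → EuclideanSpace ℂ d := fun m => mFourierCoeff (EuclideanSpace.complexify ∘ v) m
    with hV
  have hMs : Summable fun m : d → ℤ => ‖U m‖ * (Real.sqrt (freqNormSq (k - m)) * ‖V (k - m)‖) :=
    summable_convectMajorant hu hv k
  have hcs : IsSmooth (Torus.convect u v) := hu.convect hv
  have huj : ∀ j, IsSmooth (fun z => ((u z j : ℝ) : ℂ)) := fun j =>
    (hu.apply j).comp_clm Complex.ofRealCLM
  have hvp : ∀ p, IsSmooth (fun z => ((v z p : ℝ) : ℂ)) := fun p =>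
    (hv.apply p).comp_clm Complex.ofRealCLM
  have hfun : (fun y => (EuclideanSpace.complexify ∘ Torus.convect u v) y p) =
      fun y => ∑ j, (fun z => ((u z j : ℝ) : ℂ)) y *
        Torus.partialDeriv j (fun z => ((v z p : ℝ) : ℂ)) y := by
    funext y
    simp only [Function.comp_apply, EuclideanSpace.complexify_apply]
    rw [Torus.convect, fderiv_apply_eq_sum_partialDeriv (hv.isContDiff (by simp)) y (u y)]
    simp only [WithLp.ofLp_sum, WithLp.ofLp_smul, Finset.sum_apply, Pi.smul_apply, smul_eq_mul]
    push_cast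
    refine Finset.sum_congr rfl fun j _ => ?_
    rw [partialDeriv_ofReal_apply hv j p y, partialDeriv_apply_real hv j p y]
  have hcomp : mFourierCoeff (EuclideanSpace.complexify ∘ Torus.convect u v) k p =
      ∑ j, ∑' m, U m j * ((2 * Real.pi * Complex.I * ((k - m) j : ℤ)) * V (k - m) p) := by
    rw [mFourierCoeff_apply_euclidean hcs.complexify_comp.integrable, hfun,
      mFourierCoeff_finset_sum
        (f := fun j y => (fun z => ((u z j : ℝ) : ℂ)) y *
          Torus.partialDeriv j (fun z => ((v z p : ℝ) : ℂ)) y)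
        _ fun j _ => ((huj j).continuous.mul
          ((hvp p).partialDeriv j).continuous).integrable_unitAddTorus]
    refine Finset.sum_congr rfl fun j _ => ?_
    rw [mFourierCoeff_mul (huj j).continuous (summable_norm_mFourierCoeff_ofReal_apply hu j)
      ((hvp p).partialDeriv j).continuous, lconv_apply]
    refine tsum_congr fun m => ?_
    rw [← mFourierCoeff_complexify_apply hu.integrable m j,
      mFourierCoeff_partialDeriv (hvp p) j (k - m),
      ← mFourierCoeff_complexify_apply hv.integrable (k - m) p, smul_eq_mul]
  have hterm : ∀ j m, ‖U m j * ((2 * Real.pi * Complex.I * ((k - m) j : ℤ)) * V (k - m) p)‖ ≤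
      2 * Real.pi * (‖U m‖ * (Real.sqrt (freqNormSq (k - m)) * ‖V (k - m)‖)) := by
    intro j m
    rw [norm_mul, norm_mul]
    have h1 : ‖U m j‖ ≤ ‖U m‖ := PiLp.norm_apply_le _ j
    have h2 : ‖V (k - m) p‖ ≤ ‖V (k - m)‖ := PiLp.norm_apply_le _ p
    have h3 : ‖(2 * Real.pi * Complex.I * ((k - m) j : ℤ) : ℂ)‖ ≤
        2 * Real.pi * Real.sqrt (freqNormSq (k - m)) := by
      rw [norm_mul, Complex.norm_intCast]
      have : ‖(2 * Real.pi * Complex.I : ℂ)‖ = 2 * Real.pi := by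
        simp [abs_of_pos Real.pi_pos]
      rw [this]
      exact mul_le_mul_of_nonneg_left (abs_apply_le_sqrt_freqNormSq (k - m) j) (by positivity)
    calc ‖U m j‖ * (‖(2 * Real.pi * Complex.I * ((k - m) j : ℤ) : ℂ)‖ * ‖V (k - m) p‖)
        ≤ ‖U m‖ * ((2 * Real.pi * Real.sqrt (freqNormSq (k - m))) * ‖V (k - m)‖) :=
          mul_le_mul h1 (mul_le_mul h3 h2 (norm_nonneg _) (by positivity)) (by positivity)
            (norm_nonneg _)
      _ = 2 * Real.pi * (‖U m‖ * (Real.sqrt (freqNormSq (k - m)) * ‖V (k - m)‖)) := by ring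
  have hs' : ∀ j, Summable fun m =>
      U m j * ((2 * Real.pi * Complex.I * ((k - m) j : ℤ)) * V (k - m) p) := fun j =>
    Summable.of_norm_bounded (hMs.mul_left _) (hterm j)
  rw [hcomp, (Summable.tsum_finsetSum fun j _ => hs' j).symm]
  refine tsum_congr fun m => ?_
  rw [Finset.mul_sum, Finset.sum_mul]
  exact Finset.sum_congr rfl fun j _ => by ring

/-! ### §2 The commutator inequality (3.7) -/

omit [Fintype d] [DecidableEq d] in
/-- `a^s − b^s ≤ s a^{s−1} (a − b)` for `0 ≤ b ≤ a` and `s ≥ 1` (Bernoulli's inequality). [folklore] -/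
private theorem rpow_sub_rpow_le_of_le {a b s : ℝ} (hb : 0 ≤ b) (hab : b ≤ a) (hs : 1 ≤ s) :
    a ^ s - b ^ s ≤ s * a ^ (s - 1) * (a - b) := by
  rcases eq_or_lt_of_le (hb.trans hab) with ha | ha
  · -- `a = 0`, hence `b = 0`
    have hb0 : b = 0 := le_antisymm (ha ▸ hab) hb
    rw [← ha, hb0]
    simp
  · -- Bernoulli with `x = b/a − 1 ≥ −1`
    have hx : -1 ≤ b / a - 1 := by
      have : 0 ≤ b / a := div_nonneg hb ha.le
      linarith
    have hB := one_add_mul_self_le_rpow_one_add hx hs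
    rw [show 1 + (b / a - 1) = b / a by ring, Real.div_rpow hb ha.le] at hB
    -- multiply by `a^s > 0`
    have has : 0 < a ^ s := Real.rpow_pos_of_pos ha _
    have h1 : a ^ s * (1 + s * (b / a - 1)) ≤ b ^ s := by
      have := mul_le_mul_of_nonneg_left hB has.le
      rwa [mul_div_cancel₀ _ has.ne'] at this
    have e : a ^ s * (1 + s * (b / a - 1)) = a ^ s - s * a ^ (s - 1) * (a - b) := by
      rw [Real.rpow_sub ha, Real.rpow_one]
      field_simp
      ring
    linarith [e ▸ h1]

omit [Fintype d] [DecidableEq d] in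
/-- `|a^s − b^s| ≤ s |a − b| (a^{s−1} + b^{s−1})` for `a, b ≥ 0`, `s ≥ 1`. [folklore] -/
private theorem abs_rpow_sub_rpow_le {a b s : ℝ} (ha : 0 ≤ a) (hb : 0 ≤ b) (hs : 1 ≤ s) :
    |a ^ s - b ^ s| ≤ s * |a - b| * (a ^ (s - 1) + b ^ (s - 1)) := by
  have has1 : 0 ≤ a ^ (s - 1) := Real.rpow_nonneg ha _
  have hbs1 : 0 ≤ b ^ (s - 1) := Real.rpow_nonneg hb _
  rcases le_total b a with hba | hab
  · have h := rpow_sub_rpow_le_of_le hb hba hs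
    have h0 : 0 ≤ a ^ s - b ^ s := sub_nonneg.2 (Real.rpow_le_rpow hb hba (by linarith))
    rw [abs_of_nonneg h0]
    calc a ^ s - b ^ s ≤ s * a ^ (s - 1) * (a - b) := h
      _ ≤ s * |a - b| * (a ^ (s - 1) + b ^ (s - 1)) := by
          rw [abs_of_nonneg (sub_nonneg.2 hba)]
          have : 0 ≤ s * (a - b) := mul_nonneg (by linarith) (sub_nonneg.2 hba)
          nlinarith [mul_nonneg this hbs1]
  · have h := rpow_sub_rpow_le_of_le ha hab hs
    have h0 : 0 ≤ b ^ s - a ^ s := sub_nonneg.2 (Real.rpow_le_rpow ha hab (by linarith))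
    rw [abs_sub_comm, abs_of_nonneg h0]
    calc b ^ s - a ^ s ≤ s * b ^ (s - 1) * (b - a) := h
      _ ≤ s * |a - b| * (a ^ (s - 1) + b ^ (s - 1)) := by
          rw [abs_sub_comm, abs_of_nonneg (sub_nonneg.2 hab)]
          have : 0 ≤ s * (b - a) := mul_nonneg (by linarith) (sub_nonneg.2 hab)
          nlinarith [mul_nonneg this has1]

omit [DecidableEq d] in
/-- **The commutator inequality (3.7) on the lattice** (Robinson–Sadowski–Silva 2012, §III:
"`||k|^s − |j|^s| ≤ c |k−j| (|k−j|^{s−1} + |j|^{s−1})`"), with `c = s 2^s`, `s ≥ 1`,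
`|k| = (freqNormSq k)^{1/2}`: for all `k, l ∈ ℤ^n`,
`|(freqNormSq k)^{s/2} − (freqNormSq l)^{s/2}| ≤ s 2^s (freqNormSq (k−l))^{1/2}`
`· ((freqNormSq (k−l))^{(s−1)/2} + (freqNormSq l)^{(s−1)/2})`
(mean value form `|a^s − b^s| ≤ s|a−b|(a^{s−1}+b^{s−1})`, `||k| − |l|| ≤ |k − l|`,
`|k|^{s−1} ≤ 2^{s−1}(|k−l|^{s−1} + |l|^{s−1})`). [cite: RobinsonSadowskiSilva2012, §III (3.7)] -/
theorem abs_rpow_sqrt_sub_rpow_sqrt_le {s : ℝ} (hs : 1 ≤ s) (k l : d → ℤ) :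
    |freqNormSq k ^ (s / 2) - freqNormSq l ^ (s / 2)| ≤
      s * (2 : ℝ) ^ s * Real.sqrt (freqNormSq (k - l)) *
        (freqNormSq (k - l) ^ ((s - 1) / 2) + freqNormSq l ^ ((s - 1) / 2)) := by
  classical
  -- `|k|`, `|l|`, `|k − l|` and their powers as `rpow`s of the square roots
  set a : ℝ := Real.sqrt (freqNormSq k) with ha
  set b : ℝ := Real.sqrt (freqNormSq l) with hb
  set m : ℝ := Real.sqrt (freqNormSq (k - l)) with hm
  have ha0 : 0 ≤ a := Real.sqrt_nonneg _
  have hb0 : 0 ≤ b := Real.sqrt_nonneg _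
  have hm0 : 0 ≤ m := Real.sqrt_nonneg _
  have hpow : ∀ (j : d → ℤ) (t : ℝ), freqNormSq j ^ (t / 2) = Real.sqrt (freqNormSq j) ^ t := by
    intro j t
    rw [Real.sqrt_eq_rpow, ← Real.rpow_mul (freqNormSq_nonneg j)]
    congr 1
    ring
  rw [hpow k s, hpow l s, hpow (k - l) (s - 1), hpow l (s - 1)]
  -- triangle inequalities `|a − b| ≤ m`, `a ≤ m + b`
  have hkl : k - l + l = k := sub_add_cancel k l
  have hlk : l - k + k = l := sub_add_cancel l k
  have h1 : a ≤ m + b := by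
    have h := NSGevrey.sqrt_freqNormSq_add_le (k - l) l
    rwa [hkl] at h
  have h2 : b ≤ m + a := by
    have h := NSGevrey.sqrt_freqNormSq_add_le (l - k) k
    rw [hlk, show l - k = -(k - l) by abel, freqNormSq_neg] at h
    exact h
  have hab : |a - b| ≤ m := abs_sub_le_iff.2 ⟨by linarith, by linarith⟩
  -- `a^{s−1} ≤ (m + b)^{s−1} ≤ 2^{s−1}(m^{s−1} + b^{s−1})`
  have hs1 : 0 ≤ s - 1 := by linarith
  have h3 : a ^ (s - 1) ≤ (2 : ℝ) ^ (s - 1) * (m ^ (s - 1) + b ^ (s - 1)) := by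
    have hM0 : 0 ≤ max m b := le_max_of_le_left hm0
    calc a ^ (s - 1) ≤ (m + b) ^ (s - 1) := Real.rpow_le_rpow ha0 h1 hs1
      _ ≤ (2 * max m b) ^ (s - 1) :=
          Real.rpow_le_rpow (by positivity) (by linarith [le_max_left m b, le_max_right m b]) hs1
      _ = (2 : ℝ) ^ (s - 1) * (max m b) ^ (s - 1) := Real.mul_rpow (by norm_num) hM0
      _ ≤ (2 : ℝ) ^ (s - 1) * (m ^ (s - 1) + b ^ (s - 1)) := by
          refine mul_le_mul_of_nonneg_left ?_ (by positivity)
          rcases le_total m b with h | h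
          · rw [max_eq_right h]; linarith [Real.rpow_nonneg hm0 (s - 1)]
          · rw [max_eq_left h]; linarith [Real.rpow_nonneg hb0 (s - 1)]
  have h4 := abs_rpow_sub_rpow_le ha0 hb0 hs
  have h22 : (2 : ℝ) ^ (s - 1) ≤ (2 : ℝ) ^ s :=
    Real.rpow_le_rpow_of_exponent_le (by norm_num) (by linarith)
  have h21 : (1 : ℝ) ≤ (2 : ℝ) ^ s := Real.one_le_rpow (by norm_num) (by linarith)
  have hms1 : 0 ≤ m ^ (s - 1) := Real.rpow_nonneg hm0 _
  have hbs1 : 0 ≤ b ^ (s - 1) := Real.rpow_nonneg hb0 _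
  have h2s : (2 : ℝ) ^ s = 2 * (2 : ℝ) ^ (s - 1) := by
    rw [show s = 1 + (s - 1) by ring, Real.rpow_add (by norm_num : (0 : ℝ) < 2), Real.rpow_one,
      show 1 + (s - 1) - 1 = s - 1 by ring]
  have h21' : (1 : ℝ) ≤ (2 : ℝ) ^ (s - 1) := Real.one_le_rpow (by norm_num) hs1
  have h5 : a ^ (s - 1) + b ^ (s - 1) ≤ (2 : ℝ) ^ s * (m ^ (s - 1) + b ^ (s - 1)) := by
    rw [h2s]
    nlinarith [h3, mul_nonneg (sub_nonneg.2 h21') hbs1, mul_nonneg (zero_le_one.trans h21') hms1]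
  have hs0 : 0 ≤ s := by linarith
  calc |a ^ s - b ^ s| ≤ s * |a - b| * (a ^ (s - 1) + b ^ (s - 1)) := h4
    _ ≤ s * m * ((2 : ℝ) ^ s * (m ^ (s - 1) + b ^ (s - 1))) :=
        mul_le_mul (mul_le_mul_of_nonneg_left hab hs0) h5 (by positivity) (by positivity)
    _ = s * (2 : ℝ) ^ s * m * (m ^ (s - 1) + b ^ (s - 1)) := by ring

/-! ### §3 The cancellation `(B(u,w), w) = 0` in Fourier variables -/

omit [Fintype d] [DecidableEq d] in
/-- Summability over `ℤ^n × ℤ^n` of `(k, l) ↦ α_k β_l δ_{k−l}` for nonnegative `α, β ∈ ℓ¹` and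
bounded `δ`. [folklore] -/
private theorem summable_prod_mul_mul_sub {α β δ : (d → ℤ) → ℝ} (hα0 : ∀ k, 0 ≤ α k)
    (hβ0 : ∀ l, 0 ≤ β l) (hδ0 : ∀ m, 0 ≤ δ m) (hα : Summable α) (hβ : Summable β) {D : ℝ}
    (hδ : ∀ m, δ m ≤ D) :
    Summable fun q : (d → ℤ) × (d → ℤ) => α q.1 * (β q.2 * δ (q.1 - q.2)) := by
  have h0 : ∀ q : (d → ℤ) × (d → ℤ), 0 ≤ α q.1 * (β q.2 * δ (q.1 - q.2)) := fun q =>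
    mul_nonneg (hα0 _) (mul_nonneg (hβ0 _) (hδ0 _))
  have hle : ∀ k l, α k * (β l * δ (k - l)) ≤ α k * D * β l := fun k l => by
    calc α k * (β l * δ (k - l)) ≤ α k * (β l * D) :=
          mul_le_mul_of_nonneg_left (mul_le_mul_of_nonneg_left (hδ _) (hβ0 l)) (hα0 k)
      _ = α k * D * β l := by ring
  have hfib : ∀ k, Summable fun l => α k * (β l * δ (k - l)) := fun k =>
    (hβ.mul_left (α k * D)).of_nonneg_of_le (fun l => h0 (k, l)) (hle k)
  refine (summable_prod_of_nonneg fun q => h0 q).2 ⟨hfib, ?_⟩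
  refine (hα.mul_right (D * ∑' l, β l)).of_nonneg_of_le (fun k => tsum_nonneg fun l => h0 (k, l))
    fun k => ?_
  calc ∑' l, α k * (β l * δ (k - l)) ≤ ∑' l, α k * D * β l :=
        (hfib k).tsum_le_tsum (hle k) (hβ.mul_left _)
    _ = α k * (D * ∑' l, β l) := by rw [tsum_mul_left]; ring

omit [DecidableEq d] in
/-- **The cancellation `(B(u,w), w) = 0` in Fourier variables** (the lattice form of the
antisymmetry of the Navier–Stokes trilinear form used by Robinson–Sadowski–Silva 2012, §III,
proof of (3.6): "Since `(B(u,Λ^s u), Λ^s u) = 0` …"): let `û : ℤ^n → ℂ^n` be transversal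
(`∑_j m_j û_j(m) = 0`, i.e. `div u = 0`) and conjugate symmetric (`û(−m) = conj û(m)`, i.e. `u`
real), and `ŵ : ℤ^n → ℂ^n` any family with `∑_{k,l} |l| ‖û(k−l)‖ ‖ŵ(l)‖ ‖ŵ(k)‖ < ∞`. Then
`Re ∑_k ∑_l (2πi ∑_j l_j û_j(k−l)) ⟪ŵ(k), ŵ(l)⟫ = 0`
(the `(k,l)` and `(l,k)` terms are complex conjugate up to the factor `2πi`: transversality gives
`∑_j l_j û_j(k−l) = ∑_j k_j û_j(k−l)`, `û(l−k) = conj û(k−l)`, and `⟪ŵ(l), ŵ(k)⟫ = conj ⟪ŵ(k), ŵ(l)⟫;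
no symmetry of `ŵ` is needed).
[cite: RobinsonSadowskiSilva2012, §III (3.6) (proof: (B(u,Λ^s u),Λ^s u) = 0)] -/
theorem re_tsum_tsum_latticeConvect_eq_zero {U W : (d → ℤ) → EuclideanSpace ℂ d}
    (hdivU : ∀ m, ∑ j, ((m j : ℤ) : ℂ) * U m j = 0) (hU : IsConjSymm U)
    (hsum : Summable fun q : (d → ℤ) × (d → ℤ) =>
      ‖W q.1‖ * ((Real.sqrt (freqNormSq q.2) * ‖W q.2‖) * ‖U (q.1 - q.2)‖)) :
    (∑' k : d → ℤ, ∑' l : d → ℤ, (2 * Real.pi * Complex.I *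
        ∑ j, ((l j : ℤ) : ℂ) * U (k - l) j) * inner ℂ (W k) (W l)).re = 0 := by
  classical
  -- the summand as a function on pairs
  set Ψ : (d → ℤ) × (d → ℤ) → ℂ := fun q =>
    (2 * Real.pi * Complex.I * ∑ j, ((q.2 j : ℤ) : ℂ) * U (q.1 - q.2) j) * inner ℂ (W q.1) (W q.2)
    with hΨ
  have hσle : ∀ k l, ‖∑ j, ((l j : ℤ) : ℂ) * U (k - l) j‖ ≤
      (Fintype.card d : ℝ) * Real.sqrt (freqNormSq l) * ‖U (k - l)‖ := by
    intro k l
    refine (norm_sum_le _ _).trans ?_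
    calc ∑ j, ‖((l j : ℤ) : ℂ) * U (k - l) j‖ ≤ ∑ _j : d, Real.sqrt (freqNormSq l) * ‖U (k - l)‖ :=
          Finset.sum_le_sum fun j _ => by
            rw [norm_mul, Complex.norm_intCast]
            exact mul_le_mul (abs_apply_le_sqrt_freqNormSq l j) (PiLp.norm_apply_le (U (k - l)) j)
              (norm_nonneg _) (Real.sqrt_nonneg _)
      _ = (Fintype.card d : ℝ) * Real.sqrt (freqNormSq l) * ‖U (k - l)‖ := by
          rw [Finset.sum_const, Finset.card_univ, nsmul_eq_mul]
          ring
  have h2π : ‖(2 * Real.pi * Complex.I : ℂ)‖ = 2 * Real.pi := by simp [abs_of_pos Real.pi_pos]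
  have hΨle : ∀ q : (d → ℤ) × (d → ℤ), ‖Ψ q‖ ≤ 2 * Real.pi * (Fintype.card d : ℝ) *
      (‖W q.1‖ * ((Real.sqrt (freqNormSq q.2) * ‖W q.2‖) * ‖U (q.1 - q.2)‖)) := by
    intro q
    simp only [hΨ]
    rw [norm_mul, norm_mul, h2π]
    have h1 := hσle q.1 q.2
    have h2 : ‖inner ℂ (W q.1) (W q.2)‖ ≤ ‖W q.1‖ * ‖W q.2‖ := norm_inner_le_norm _ _
    calc 2 * Real.pi * ‖∑ j, ((q.2 j : ℤ) : ℂ) * U (q.1 - q.2) j‖ * ‖inner ℂ (W q.1) (W q.2)‖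
        ≤ 2 * Real.pi * ((Fintype.card d : ℝ) * Real.sqrt (freqNormSq q.2) * ‖U (q.1 - q.2)‖) *
            (‖W q.1‖ * ‖W q.2‖) :=
          mul_le_mul (mul_le_mul_of_nonneg_left h1 (by positivity)) h2 (norm_nonneg _)
            (by positivity)
      _ = 2 * Real.pi * (Fintype.card d : ℝ) *
            (‖W q.1‖ * ((Real.sqrt (freqNormSq q.2) * ‖W q.2‖) * ‖U (q.1 - q.2)‖)) := by ring
  have hΨs : Summable Ψ := Summable.of_norm_bounded (hsum.mul_left _) hΨle
  have hΨs' : Summable fun q : (d → ℤ) × (d → ℤ) => Ψ q.swap := hΨs.prod_symm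
  -- the iterated sum is the sum over pairs, which is swap invariant
  have hS : (∑' k : d → ℤ, ∑' l : d → ℤ, (2 * Real.pi * Complex.I *
      ∑ j, ((l j : ℤ) : ℂ) * U (k - l) j) * inner ℂ (W k) (W l)) = ∑' q, Ψ q := by
    rw [hΨs.tsum_prod]
  have hswap : ∑' q : (d → ℤ) × (d → ℤ), Ψ q.swap = ∑' q, Ψ q :=
    (Equiv.prodComm (d → ℤ) (d → ℤ)).tsum_eq Ψ
  -- pointwise: `Ψ(k,l) + Ψ(l,k)` is purely imaginary
  have hpt : ∀ q : (d → ℤ) × (d → ℤ), (Ψ q + Ψ q.swap).re = 0 := by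
    rintro ⟨k, l⟩
    -- transversality: `∑ l_j û_j(k−l) = ∑ k_j û_j(k−l)`
    have hτ : ∑ j, ((l j : ℤ) : ℂ) * U (k - l) j = ∑ j, ((k j : ℤ) : ℂ) * U (k - l) j := by
      have h0 := hdivU (k - l)
      simp only [Pi.sub_apply, Int.cast_sub, sub_mul, Finset.sum_sub_distrib, sub_eq_zero] at h0
      exact h0.symm
    -- conjugate symmetry: `∑ k_j û_j(l−k) = conj (∑ k_j û_j(k−l))`
    have hσ' : ∑ j, ((k j : ℤ) : ℂ) * U (l - k) j = conj (∑ j, ((l j : ℤ) : ℂ) * U (k - l) j) := by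
      rw [hτ, map_sum]
      refine Finset.sum_congr rfl fun j _ => ?_
      rw [show l - k = -(k - l) by abel, hU (k - l), EuclideanSpace.conjVec_apply, map_mul,
        map_intCast]
    have hG : inner ℂ (W l) (W k) = conj (inner ℂ (W k) (W l)) := (inner_conj_symm _ _).symm
    have eΨ : Ψ (k, l) + Ψ (k, l).swap =
        2 * Real.pi * Complex.I * ((∑ j, ((l j : ℤ) : ℂ) * U (k - l) j) * inner ℂ (W k) (W l) +
          conj ((∑ j, ((l j : ℤ) : ℂ) * U (k - l) j) * inner ℂ (W k) (W l))) := by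
      simp only [hΨ, Prod.swap_prod_mk]
      rw [hσ', hG, map_mul]
      ring
    rw [eΨ, Complex.add_conj]
    simp
  -- conclude: `2 Re S = Re ∑ (Ψ q + Ψ q.swap) = 0`
  have h2 : (∑' q, Ψ q) + (∑' q : (d → ℤ) × (d → ℤ), Ψ q.swap) =
      ∑' q : (d → ℤ) × (d → ℤ), (Ψ q + Ψ q.swap) := (hΨs.tsum_add hΨs').symm
  have hre : ((∑' q, Ψ q) + (∑' q : (d → ℤ) × (d → ℤ), Ψ q.swap)).re = 0 := by
    rw [h2, Complex.re_tsum (hΨs.add hΨs'), tsum_congr hpt, tsum_zero]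
  rw [hswap, Complex.add_re] at hre
  rw [hS]
  linarith

/-! ### §4 The trilinear estimate (3.6) -/

/-- **Robinson–Sadowski–Silva (3.6) on the lattice**: "`|(B(u,u), A^s u)| ≤ c ‖u‖_s² ‖u‖_{F_1}`
for `s ≥ 1`". For a smooth divergence-free real field `u` on `T^n` and `s ≥ 1`,
`|∑_k |k|^{2s} Re⟪𝓕((u·∇)u)(k), û(k)⟫| ≤ 4π n s 2^s (∑_k |k|^{2s} ‖û(k)‖²) (∑_k |k| ‖û(k)‖)`
(`|k|^{2t} = (freqNormSq k)^t`; the left-hand side is the nonlinear term in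
`½ d/dt ‖u‖²_{Ḣ^s}`). Proof as printed: with `ŵ(k) = |k|^s û(k)`, the cancellation
`NSSobolev.re_tsum_tsum_latticeConvect_eq_zero` removes `Re ∑∑ (2πi ∑ l_j û_j(k−l)) ⟪ŵ(k), ŵ(l)⟫`,
leaving the commutator `|k|^s(|k|^s − |l|^s)`, bounded by (3.7)
(`NSSobolev.abs_rpow_sqrt_sub_rpow_sqrt_le`); then Young's inequality `ℓ¹ ∗ ℓ² ⊂ ℓ²`
(`NSGevrey.sum_mul_tsum_mul_le`). [cite: RobinsonSadowskiSilva2012, §III (3.6)] -/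
theorem abs_tsum_rpow_mul_re_inner_convect_le (hu : IsSmooth u) (hdiv : IsDivFree u) {s : ℝ}
    (hs : 1 ≤ s) :
    |∑' k : d → ℤ, freqNormSq k ^ s *
        (inner ℂ (mFourierCoeff (EuclideanSpace.complexify ∘ Torus.convect u u) k)
          (mFourierCoeff (EuclideanSpace.complexify ∘ u) k)).re| ≤
      4 * Real.pi * (Fintype.card d : ℝ) * (s * (2 : ℝ) ^ s) *
        (∑' k : d → ℤ, freqNormSq k ^ s * ‖mFourierCoeff (EuclideanSpace.complexify ∘ u) k‖ ^ 2) *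
        (∑' k : d → ℤ, Real.sqrt (freqNormSq k) *
          ‖mFourierCoeff (EuclideanSpace.complexify ∘ u) k‖) := by
  classical
  set U : (d → ℤ) → EuclideanSpace ℂ d := fun m => mFourierCoeff (EuclideanSpace.complexify ∘ u) m
    with hUdef
  -- ### weights and their summability
  set a : (d → ℤ) → ℝ := fun m => ‖U m‖ with ha
  set r : (d → ℤ) → ℝ := fun m => Real.sqrt (freqNormSq m) with hr
  set ρ : (d → ℤ) → ℝ := fun m => freqNormSq m ^ (s / 2) with hρ
  set ρ₁ : (d → ℤ) → ℝ := fun m => freqNormSq m ^ ((s - 1) / 2) with hρ₁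
  set b : (d → ℤ) → ℝ := fun m => ρ m * a m with hb
  set a₁ : (d → ℤ) → ℝ := fun m => r m * a m with ha₁
  have ha0 : ∀ m, 0 ≤ a m := fun m => norm_nonneg _
  have hr0 : ∀ m, 0 ≤ r m := fun m => Real.sqrt_nonneg _
  have hρ0 : ∀ m, 0 ≤ ρ m := fun m => Real.rpow_nonneg (freqNormSq_nonneg m) _
  have hρ₁0 : ∀ m, 0 ≤ ρ₁ m := fun m => Real.rpow_nonneg (freqNormSq_nonneg m) _
  have hb0 : ∀ m, 0 ≤ b m := fun m => mul_nonneg (hρ0 m) (ha0 m)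
  have ha₁0 : ∀ m, 0 ≤ a₁ m := fun m => mul_nonneg (hr0 m) (ha0 m)
  have hRD := hu.complexify_comp.rapidDecay_mFourierCoeff
  have has : Summable a := hRD.summable_norm
  -- `∑ |m|^{2t}·‖û m‖ < ∞` for every `t ≥ 0`
  have hpow : ∀ {t : ℝ}, 0 ≤ t → Summable fun m : d → ℤ => freqNormSq m ^ t * a m := by
    intro t ht
    obtain ⟨N, hN⟩ := exists_nat_ge t
    refine (hRD N).of_nonneg_of_le (fun m => mul_nonneg (Real.rpow_nonneg (freqNormSq_nonneg m) _)
      (ha0 m)) fun m => ?_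
    refine mul_le_mul_of_nonneg_right ?_ (ha0 m)
    calc freqNormSq m ^ t ≤ (1 + freqNormSq m) ^ t :=
          Real.rpow_le_rpow (freqNormSq_nonneg m) (by linarith) ht
      _ ≤ (1 + freqNormSq m) ^ (N : ℝ) :=
          Real.rpow_le_rpow_of_exponent_le (by linarith [freqNormSq_nonneg m]) hN
      _ = (1 + freqNormSq m) ^ N := Real.rpow_natCast _ _
  have hr_eq : ∀ m, r m = freqNormSq m ^ (1 / 2 : ℝ) := fun m => Real.sqrt_eq_rpow _
  have hrρ₁ : ∀ m, r m * ρ₁ m = ρ m := fun m => by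
    rw [hr_eq, hρ₁, hρ]
    simp only
    rw [← Real.rpow_add' (freqNormSq_nonneg m) (by linarith : (1 / 2 : ℝ) + (s - 1) / 2 ≠ 0)]
    congr 1
    ring
  have hρsq : ∀ m, ρ m * ρ m = freqNormSq m ^ s := fun m => by
    rw [hρ]
    simp only
    rw [← Real.rpow_add' (freqNormSq_nonneg m) (by linarith : s / 2 + s / 2 ≠ 0)]
    congr 1
    ring
  have hbs : Summable b := (hpow (by linarith : (0 : ℝ) ≤ s / 2)).congr fun m => by
    simp only [hb, hρ]
  have ha₁s : Summable a₁ := (hpow (by norm_num : (0 : ℝ) ≤ 1 / 2)).congr fun m => by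
    simp only [ha₁, hr_eq]
  have hrbs : Summable fun m => r m * b m :=
    (hpow (by linarith : (0 : ℝ) ≤ (s + 1) / 2)).congr fun m => by
      simp only [hb, hr_eq, hρ]
      rw [← mul_assoc, ← Real.rpow_add' (freqNormSq_nonneg m)
        (by linarith : (1 / 2 : ℝ) + s / 2 ≠ 0)]
      congr 2
      ring
  have hb2 : ∀ m, b m ^ 2 = freqNormSq m ^ s * ‖U m‖ ^ 2 := fun m => by
    simp only [hb, ha]
    rw [mul_pow, sq, hρsq]
  have hb2s : Summable fun m => b m ^ 2 :=
    (hu.summable_freqNormSq_rpow_mul_norm_sq (by linarith : (0 : ℝ) ≤ s)).congr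
      fun m => (hb2 m).symm
  set X : ℝ := ∑' k, freqNormSq k ^ s * ‖U k‖ ^ 2 with hX
  set F₁ : ℝ := ∑' k, r k * a k with hF₁
  have hXb : ∑' m, b m ^ 2 = X := tsum_congr hb2
  have hX0 : 0 ≤ X := by rw [← hXb]; exact tsum_nonneg fun m => sq_nonneg _
  have hF₁0 : 0 ≤ F₁ := tsum_nonneg fun m => ha₁0 m
  -- bounds `a ≤ A`, `b ≤ B₀`, `a₁ ≤ F₁`
  have hAle : ∀ m, a m ≤ ∑' j, a j := fun m => has.le_tsum m fun j _ => ha0 j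
  have hBle : ∀ m, b m ≤ ∑' j, b j := fun m => hbs.le_tsum m fun j _ => hb0 j
  have hA₁le : ∀ m, a₁ m ≤ F₁ := fun m => ha₁s.le_tsum m fun j _ => ha₁0 j
  -- ### the pieces on `ℤ^n × ℤ^n`
  set W : (d → ℤ) → EuclideanSpace ℂ d := fun k => (ρ k : ℂ) • U k with hW
  have hWn : ∀ k, ‖W k‖ = b k := fun k => by
    simp only [hW, hb, ha]
    rw [norm_smul, Complex.norm_real, Real.norm_of_nonneg (hρ0 k)]
  set c : (d → ℤ) → (d → ℤ) → ℂ := fun k l =>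
    2 * Real.pi * Complex.I * ∑ j, ((l j : ℤ) : ℂ) * U (k - l) j with hc
  set Φ : (d → ℤ) × (d → ℤ) → ℂ := fun q =>
    (2 * Real.pi * Complex.I * ∑ j, ((q.2 j : ℤ) : ℂ) * U (q.1 - q.2) j) *
      inner ℂ (W q.1) (W q.2) with hΦ
  set E : (d → ℤ) × (d → ℤ) → ℂ := fun q =>
    c q.1 q.2 * (((ρ q.1 * (ρ q.1 - ρ q.2) : ℝ)) : ℂ) * inner ℂ (U q.1) (U q.2) with hE
  set C : ℝ := 2 * Real.pi * (Fintype.card d : ℝ) * (s * (2 : ℝ) ^ s) with hC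
  have hC0 : 0 ≤ C := by positivity
  set G : (d → ℤ) × (d → ℤ) → ℝ := fun q =>
    C * (b q.1 * (a₁ q.2 * b (q.1 - q.2)) + b q.1 * (b q.2 * a₁ (q.1 - q.2))) with hG
  -- `|c k l| ≤ 2π n |l| ‖û(k−l)‖`
  have h2π : ‖(2 * Real.pi * Complex.I : ℂ)‖ = 2 * Real.pi := by simp [abs_of_pos Real.pi_pos]
  have hcle : ∀ k l, ‖c k l‖ ≤ 2 * Real.pi * (Fintype.card d : ℝ) * (r l * a (k - l)) := by
    intro k l
    simp only [hc]
    rw [norm_mul, h2π]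
    have h1 : ‖∑ j, ((l j : ℤ) : ℂ) * U (k - l) j‖ ≤ (Fintype.card d : ℝ) * (r l * a (k - l)) := by
      refine (norm_sum_le _ _).trans ?_
      calc ∑ j, ‖((l j : ℤ) : ℂ) * U (k - l) j‖ ≤ ∑ _j : d, r l * a (k - l) :=
            Finset.sum_le_sum fun j _ => by
              rw [norm_mul, Complex.norm_intCast]
              exact mul_le_mul (abs_apply_le_sqrt_freqNormSq l j)
                (PiLp.norm_apply_le (U (k - l)) j) (norm_nonneg _) (Real.sqrt_nonneg _)
        _ = (Fintype.card d : ℝ) * (r l * a (k - l)) := by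
            rw [Finset.sum_const, Finset.card_univ, nsmul_eq_mul]
    calc 2 * Real.pi * ‖∑ j, ((l j : ℤ) : ℂ) * U (k - l) j‖
        ≤ 2 * Real.pi * ((Fintype.card d : ℝ) * (r l * a (k - l))) :=
          mul_le_mul_of_nonneg_left h1 (by positivity)
      _ = 2 * Real.pi * (Fintype.card d : ℝ) * (r l * a (k - l)) := by ring
  -- `‖E(k,l)‖ ≤ G(k,l)`
  have hEle : ∀ q : (d → ℤ) × (d → ℤ), ‖E q‖ ≤ G q := by
    rintro ⟨k, l⟩
    simp only [hE, hG]
    rw [norm_mul, norm_mul, Complex.norm_real, Real.norm_eq_abs, abs_mul, abs_of_nonneg (hρ0 k)]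
    have h1 := hcle k l
    have h2 : |ρ k - ρ l| ≤ s * (2 : ℝ) ^ s * r (k - l) * (ρ₁ (k - l) + ρ₁ l) :=
      abs_rpow_sqrt_sub_rpow_sqrt_le hs k l
    have h3 : ‖inner ℂ (U k) (U l)‖ ≤ a k * a l := norm_inner_le_norm _ _
    have hn1 : 0 ≤ ρ k * |ρ k - ρ l| := mul_nonneg (hρ0 k) (abs_nonneg _)
    have hn2 : 0 ≤ 2 * Real.pi * (Fintype.card d : ℝ) * (r l * a (k - l)) := by
      have := hr0 l; have := ha0 (k - l); positivity
    have hn3 : 0 ≤ (2 * Real.pi * (Fintype.card d : ℝ) * (r l * a (k - l))) *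
        (ρ k * (s * (2 : ℝ) ^ s * r (k - l) * (ρ₁ (k - l) + ρ₁ l))) := by
      have := hr0 (k - l); have := hρ₁0 (k - l); have := hρ₁0 l; have := hρ0 k
      have : (0 : ℝ) ≤ s := by linarith
      positivity
    have h4 : ‖c k l‖ * (ρ k * |ρ k - ρ l|) * ‖inner ℂ (U k) (U l)‖ ≤
        (2 * Real.pi * (Fintype.card d : ℝ) * (r l * a (k - l))) *
          (ρ k * (s * (2 : ℝ) ^ s * r (k - l) * (ρ₁ (k - l) + ρ₁ l))) * (a k * a l) :=
      mul_le_mul (mul_le_mul h1 (mul_le_mul_of_nonneg_left h2 (hρ0 k)) hn1 hn2) h3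
        (norm_nonneg _) hn3
    refine h4.trans (le_of_eq ?_)
    -- `r·ρ₁ = ρ`, and regrouping into `b`, `a₁`
    have e1 : r (k - l) * ρ₁ (k - l) = ρ (k - l) := hrρ₁ (k - l)
    have e2 : r l * ρ₁ l = ρ l := hrρ₁ l
    simp only [hb, ha₁, hC]
    rw [← e1, ← e2]
    ring
  -- summability over pairs
  have hG0 : ∀ q : (d → ℤ) × (d → ℤ), 0 ≤ G q := fun q =>
    mul_nonneg hC0 (add_nonneg (mul_nonneg (hb0 _) (mul_nonneg (ha₁0 _) (hb0 _)))
      (mul_nonneg (hb0 _) (mul_nonneg (hb0 _) (ha₁0 _))))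
  have hGs : Summable G := by
    have h1 := summable_prod_mul_mul_sub hb0 ha₁0 hb0 hbs ha₁s hBle
    have h2 := summable_prod_mul_mul_sub hb0 hb0 ha₁0 hbs hbs hA₁le
    exact ((h1.add h2).mul_left C).congr fun q => by simp only [hG]
  have hEs : Summable E := Summable.of_norm_bounded hGs hEle
  have hΦsum : Summable fun q : (d → ℤ) × (d → ℤ) =>
      ‖W q.1‖ * ((Real.sqrt (freqNormSq q.2) * ‖W q.2‖) * ‖U (q.1 - q.2)‖) := by
    have h1 := summable_prod_mul_mul_sub hb0 (fun l => mul_nonneg (hr0 l) (hb0 l)) ha0 hbs hrbs hAle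
    exact h1.congr fun q => by simp only [hWn, hr, ha]
  have hΦs : Summable Φ := by
    have hΦle : ∀ q : (d → ℤ) × (d → ℤ), ‖Φ q‖ ≤ 2 * Real.pi * (Fintype.card d : ℝ) *
        (‖W q.1‖ * ((Real.sqrt (freqNormSq q.2) * ‖W q.2‖) * ‖U (q.1 - q.2)‖)) := by
      rintro ⟨k, l⟩
      simp only [hΦ]
      rw [norm_mul]
      have h1 := hcle k l
      have h2 : ‖inner ℂ (W k) (W l)‖ ≤ ‖W k‖ * ‖W l‖ := norm_inner_le_norm _ _
      calc ‖c k l‖ * ‖inner ℂ (W k) (W l)‖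
          ≤ (2 * Real.pi * (Fintype.card d : ℝ) * (r l * a (k - l))) * (‖W k‖ * ‖W l‖) :=
            mul_le_mul h1 h2 (norm_nonneg _) (by positivity)
        _ = 2 * Real.pi * (Fintype.card d : ℝ) * (‖W k‖ * ((r l * ‖W l‖) * a (k - l))) := by ring
    exact Summable.of_norm_bounded (hΦsum.mul_left _) hΦle
  -- ### the convective coefficient as a series in `l = k − m`
  have hB : ∀ k p, mFourierCoeff (EuclideanSpace.complexify ∘ Torus.convect u u) k p =
      ∑' l, c k l * U l p := by
    intro k p
    rw [mFourierCoeff_convect_apply_eq_tsum hu hu k p,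
      ← (Equiv.subLeft k).tsum_eq (fun m => (2 * Real.pi * Complex.I *
        ∑ j, (((k - m) j : ℤ) : ℂ) * U m j) * U (k - m) p)]
    refine tsum_congr fun l => ?_
    simp only [Equiv.subLeft_apply, sub_sub_cancel, hc]
  -- the inner product `⟪û(k), 𝓕((u·∇)u)(k)⟫ = ∑_l c(k,l) ⟪û(k), û(l)⟫`
  have hcUs : ∀ k p, Summable fun l => c k l * U l p := by
    intro k p
    refine Summable.of_norm_bounded ((ha₁s.mul_left (2 * Real.pi * (Fintype.card d : ℝ) *
      ∑' j, a j))) fun l => ?_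
    rw [norm_mul]
    calc ‖c k l‖ * ‖U l p‖ ≤ (2 * Real.pi * (Fintype.card d : ℝ) * (r l * a (k - l))) * a l :=
          mul_le_mul (hcle k l) (PiLp.norm_apply_le (U l) p) (norm_nonneg _) (by positivity)
      _ ≤ (2 * Real.pi * (Fintype.card d : ℝ) * (r l * ∑' j, a j)) * a l := by
          gcongr
          exact hAle (k - l)
      _ = 2 * Real.pi * (Fintype.card d : ℝ) * (∑' j, a j) * (r l * a l) := by ring
  have hinner : ∀ k, inner ℂ (U k) (mFourierCoeff (EuclideanSpace.complexify ∘ Torus.convect u u) k) =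
      ∑' l, c k l * inner ℂ (U k) (U l) := by
    intro k
    rw [PiLp.inner_apply]
    simp_rw [RCLike.inner_apply', hB k]
    rw [show (∑ p, conj (U k p) * ∑' l, c k l * U l p) = ∑ p, ∑' l, conj (U k p) * (c k l * U l p)
      from Finset.sum_congr rfl fun p _ => (tsum_mul_left).symm]
    rw [← Summable.tsum_finsetSum fun p _ => (hcUs k p).mul_left _]
    refine tsum_congr fun l => ?_
    rw [PiLp.inner_apply, Finset.mul_sum]
    exact Finset.sum_congr rfl fun p _ => by rw [RCLike.inner_apply']; ring
  -- ### the termwise splitting `|k|^{2s} Re⟪B̂(k), û(k)⟫ = Re ∑_l E(k,l) + Re ∑_l Φ(k,l)`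
  have hEfib : ∀ k, Summable fun l => E (k, l) := fun k => hEs.prod_factor k
  have hΦfib : ∀ k, Summable fun l => Φ (k, l) := fun k => hΦs.prod_factor k
  have hsplit : ∀ k, freqNormSq k ^ s *
      (inner ℂ (mFourierCoeff (EuclideanSpace.complexify ∘ Torus.convect u u) k) (U k)).re =
      (∑' l, E (k, l)).re + (∑' l, Φ (k, l)).re := by
    intro k
    have hsym : (inner ℂ (mFourierCoeff (EuclideanSpace.complexify ∘ Torus.convect u u) k)
        (U k)).re = (inner ℂ (U k)
          (mFourierCoeff (EuclideanSpace.complexify ∘ Torus.convect u u) k)).re := by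
      rw [← inner_conj_symm, Complex.conj_re]
    rw [hsym, hinner k, ← Complex.re_ofReal_mul, ← Complex.add_re,
      ← (hEfib k).tsum_add (hΦfib k), ← tsum_mul_left]
    congr 1
    refine tsum_congr fun l => ?_
    simp only [hE, hΦ, hW, hc]
    rw [inner_smul_left, inner_smul_right, Complex.conj_ofReal, ← hρsq k]
    push_cast
    ring
  -- ### summation over `k`
  have hGfib : ∀ k, Summable fun l => G (k, l) := fun k => hGs.prod_factor k
  have hEre_le : ∀ k, ‖(∑' l, E (k, l)).re‖ ≤ ∑' l, G (k, l) := fun k => by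
    rw [Real.norm_eq_abs]
    calc |(∑' l, E (k, l)).re| ≤ ‖∑' l, E (k, l)‖ := Complex.abs_re_le_norm _
      _ ≤ ∑' l, ‖E (k, l)‖ := norm_tsum_le_tsum_norm (hEfib k).norm
      _ ≤ ∑' l, G (k, l) := (hEfib k).norm.tsum_le_tsum (fun l => hEle (k, l)) (hGfib k)
  have hEre_s : Summable fun k => (∑' l, E (k, l)).re :=
    Summable.of_norm_bounded hGs.prod hEre_le
  have hΦre_s : Summable fun k => (∑' l, Φ (k, l)).re := (Complex.hasSum_re hΦs.prod.hasSum).summable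
  -- the `Φ` part vanishes (cancellation)
  have hΦzero : ∑' k, (∑' l, Φ (k, l)).re = 0 := by
    rw [← Complex.re_tsum hΦs.prod]
    exact re_tsum_tsum_latticeConvect_eq_zero (W := W)
      (fun m => IsDivFree.sum_mul_mFourierCoeff_eq_zero hu hdiv m)
      (isConjSymm_mFourierCoeff hu.integrable) hΦsum
  -- the `E` part is bounded by `∑ G ≤ 2 C F₁ X`
  have hGsum_le : ∑' k, ∑' l, G (k, l) ≤ 2 * C * F₁ * X := by
    -- `∑_l G(k,l) = 2 C b_k ∑_l a₁(l) b(k−l)`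
    have hconv : ∀ k, Summable fun l => a₁ l * b (k - l) := fun k =>
      (ha₁s.mul_right (∑' j, b j)).of_nonneg_of_le (fun l => mul_nonneg (ha₁0 l) (hb0 _))
        fun l => mul_le_mul_of_nonneg_left (hBle _) (ha₁0 l)
    have hre : ∀ k, ∑' l, b l * a₁ (k - l) = ∑' l, a₁ l * b (k - l) := fun k => by
      rw [← (Equiv.subLeft k).tsum_eq (fun l => b l * a₁ (k - l))]
      refine tsum_congr fun l => ?_
      simp only [Equiv.subLeft_apply, sub_sub_cancel]
      ring
    have hconv' : ∀ k, Summable fun l => b l * a₁ (k - l) := fun k =>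
      (hbs.mul_right F₁).of_nonneg_of_le (fun l => mul_nonneg (hb0 l) (ha₁0 _))
        fun l => mul_le_mul_of_nonneg_left (hA₁le _) (hb0 l)
    have hGk : ∀ k, ∑' l, G (k, l) = 2 * C * (b k * ∑' l, a₁ l * b (k - l)) := by
      intro k
      simp only [hG]
      rw [tsum_mul_left, ((hconv k).mul_left (b k)).tsum_add ((hconv' k).mul_left (b k)),
        tsum_mul_left, tsum_mul_left, hre k]
      ring
    rw [tsum_congr hGk, tsum_mul_left]
    -- finite partial sums and Young
    have hK : ∀ K : Finset (d → ℤ), ∑ k ∈ K, b k * ∑' l, a₁ l * b (k - l) ≤ F₁ * X := by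
      intro K
      have hY := NSGevrey.sum_mul_tsum_mul_le K ha₁0 hb0 hb0 ha₁s hb2s
      have h1 : Real.sqrt (∑ k ∈ K, b k ^ 2) ≤ Real.sqrt X :=
        Real.sqrt_le_sqrt (by rw [← hXb]; exact hb2s.sum_le_tsum K fun m _ => sq_nonneg _)
      calc ∑ k ∈ K, b k * ∑' l, a₁ l * b (k - l)
          ≤ (∑' j, a₁ j) * Real.sqrt (∑' j, b j ^ 2) * Real.sqrt (∑ k ∈ K, b k ^ 2) := hY
        _ ≤ F₁ * Real.sqrt X * Real.sqrt X := by
            rw [hXb]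
            exact mul_le_mul_of_nonneg_left h1 (mul_nonneg hF₁0 (Real.sqrt_nonneg _))
        _ = F₁ * X := by rw [mul_assoc, Real.mul_self_sqrt hX0]
    have htb : ∑' k, b k * ∑' l, a₁ l * b (k - l) ≤ F₁ * X :=
      Real.tsum_le_of_sum_le (fun k => mul_nonneg (hb0 k) (tsum_nonneg fun l =>
        mul_nonneg (ha₁0 l) (hb0 _))) hK
    have h2C : 0 ≤ 2 * C := by positivity
    calc 2 * C * ∑' k, b k * ∑' l, a₁ l * b (k - l) ≤ 2 * C * (F₁ * X) :=
          mul_le_mul_of_nonneg_left htb h2C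
      _ = 2 * C * F₁ * X := by ring
  -- ### conclusion
  rw [tsum_congr hsplit, hEre_s.tsum_add hΦre_s, hΦzero, add_zero]
  calc |∑' k, (∑' l, E (k, l)).re| ≤ ∑' k, ‖(∑' l, E (k, l)).re‖ := by
        rw [← Real.norm_eq_abs]
        exact norm_tsum_le_tsum_norm hEre_s.norm
    _ ≤ ∑' k, ∑' l, G (k, l) := hEre_s.norm.tsum_le_tsum hEre_le hGs.prod
    _ ≤ 2 * C * F₁ * X := hGsum_le
    _ = 4 * Real.pi * (Fintype.card d : ℝ) * (s * (2 : ℝ) ^ s) * X * F₁ := by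
        simp only [hC]
        ring

end NSSobolev

end Literature.Analysis.FluidPDE

end
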